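import Mathlib.Analysis.SpecialFunctions.Complex.Arg
import Literature.Computability.QuantumComplexity.QFTQubits
import HarnessLib

/-!
# Reading a phase off a grid of noisy cosine scores (van Dam–Seroussi, analysis IV)

Topic `Literature/Computability/Cryptography`; fourth analysis file towards the discharge of
`VanDamSeroussi2002_cubicGaussSumPhase_qsolvable`. Van Dam–Seroussi estimate the unknown phase `γ` of
`e^{iγ}` (their Fact 2, §3.1) by measuring along `(|0⟩ ± e^{iφ}|1⟩)/√2` for "various different angles
`φ`": the frequency of the outcome `+` is `(1 + cos(γ − φ))/2`. The classical post-processor of the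
tree's algorithm does exactly this on the grid `φ_j = 2πj/(4t)`, `j < 4t`: from any scores `σ_j`
within `ε₁` of `A·cos(γ − φ_j)` (`A > 0` an unknown common amplitude) it takes a maximising index `ĵ`
and outputs `m = ⌊(ĵ+2)/4⌋ mod t`. This file proves that this `m` is a valid answer of the search
problem `VanDamSeroussi2002_cubicGaussSumPhase_qsolvable` at precision `t`, i.e.
`|arg(u · e(−m/t))| ≤ 2π/t` for the unit vector `u = e^{iγ}`, as soon as
`2ε₁ < A·(cos(π/(4t)) − cos(2π/(4t)))` (everything PROVED, [folklore] trigonometry):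

* `re_mul_conj_eR_eq_cos` — `Re(u · conj e(q)) = cos(arg u − 2πq)` for a unit `u`;
* `exists_grid_ge_cos` — some grid angle is within `π/(4t)`: `Re(u · conj e(j/(4t))) ≥ cos(π/(4t))`;
* `abs_arg_lt_of_re_gt_cos` — `Re w > cos θ` forces `|arg w| < θ` for a unit `w`, `0 ≤ θ ≤ π`;
* **`abs_arg_grid_output_le`** — the maximiser's output `m = ⌊(ĵ+2)/4⌋ mod t` satisfies
  `|arg(u · conj e(m/t))| ≤ 2π/t` (for `t ≥ 2`; `t = 1` is trivial, `|arg| ≤ π`).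

## References

* W. van Dam, G. Seroussi, arXiv:quant-ph/0207131 (2002), §3.1 Fact 2 (measuring along `|0⟩ + e^{iφ}|1⟩`
  for various `φ`), §4 Thm. 1 [VanDamSeroussi2002].
* A. Yu. Kitaev, arXiv:quant-ph/9511026 (1995), §3 Remark 8 (`P(0) = (1 + cos 2πφ)/2`) [Kitaev1995].
-/

noncomputable section

namespace Literature.Computability.Cryptography

namespace VanDamSeroussi

open Complex Real
open Literature.Computability.QuantumComplexity.QFTQubits

/-! ### Unit vectors and the phase `e` -/

/-- `e(q) = exp((2πq) i)`. [folklore] -/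
theorem eR_eq_exp_mul_I (q : ℝ) : eR q = Complex.exp (((2 * π * q : ℝ) : ℂ) * I) := by
  unfold eR; congr 1; push_cast; ring

/-- `conj e(q) = e(−q)`. [folklore] -/
theorem conj_eR (q : ℝ) : (starRingEnd ℂ) (eR q) = eR (-q) := by
  rw [eR_eq_exp_mul_I, eR_eq_exp_mul_I, ← Complex.exp_conj, map_mul, Complex.conj_ofReal, Complex.conj_I]
  congr 1; push_cast; ring

/-- A unit vector is `exp(arg · i)`. [folklore] -/
theorem eq_exp_arg_of_norm_eq_one {u : ℂ} (hu : ‖u‖ = 1) : u = Complex.exp (arg u * I) := by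
  have := norm_mul_exp_arg_mul_I u
  rw [hu, Complex.ofReal_one, one_mul] at this
  exact this.symm

/-- `u · conj e(q) = exp((arg u − 2πq) i)` for a unit vector `u`. [folklore] -/
theorem mul_conj_eR_eq_exp {u : ℂ} (hu : ‖u‖ = 1) (q : ℝ) :
    u * (starRingEnd ℂ) (eR q) = Complex.exp (((arg u - 2 * π * q : ℝ) : ℂ) * I) := by
  nth_rewrite 1 [eq_exp_arg_of_norm_eq_one hu]
  rw [conj_eR, eR_eq_exp_mul_I, ← Complex.exp_add]
  congr 1; push_cast; ring

/-- **`Re(u · conj e(q)) = cos(arg u − 2πq)`** for a unit vector `u`. [folklore] -/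
theorem re_mul_conj_eR_eq_cos {u : ℂ} (hu : ‖u‖ = 1) (q : ℝ) :
    (u * (starRingEnd ℂ) (eR q)).re = Real.cos (arg u - 2 * π * q) := by
  rw [mul_conj_eR_eq_exp hu, Complex.exp_ofReal_mul_I_re]

/-- The argument of `exp(x i)` is `x` when `x ∈ (−π, π]`. [folklore] -/
theorem arg_exp_ofReal_mul_I {x : ℝ} (hx : x ∈ Set.Ioc (-π) π) : arg (Complex.exp ((x : ℂ) * I)) = x := by
  rw [Complex.exp_mul_I]
  exact arg_cos_add_sin_mul_I hx

/-- **`Re w > cos θ` forces `|arg w| < θ`** for a unit vector `w` and `0 ≤ θ`. [folklore] -/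
theorem abs_arg_lt_of_re_gt_cos {w : ℂ} (hw : ‖w‖ = 1) {θ : ℝ} (h0 : 0 ≤ θ)
    (h : Real.cos θ < w.re) : |arg w| < θ := by
  have hw0 : w ≠ 0 := fun h0 => by rw [h0, norm_zero] at hw; exact zero_ne_one hw
  have hcos : Real.cos (arg w) = w.re := by rw [cos_arg hw0, hw, div_one]
  by_contra hle
  push Not at hle
  have habs : Real.cos |arg w| = Real.cos (arg w) := by
    rcases le_or_gt 0 (arg w) with ha | ha
    · rw [abs_of_nonneg ha]
    · rw [abs_of_neg ha, Real.cos_neg]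
  have := cos_le_cos_of_nonneg_of_le_pi h0 (abs_arg_le_pi w) hle
  rw [habs, hcos] at this
  linarith

/-! ### A grid point near every phase -/

/-- **Some grid angle `2πj/T` is within `π/T` of the phase**: for a unit `u` and `T ≥ 1` there is
`j < T` with `Re(u · conj e(j/T)) ≥ cos(π/T)` (round `arg u · T/(2π)` to the nearest integer).
[folklore] -/
theorem exists_grid_ge_cos {u : ℂ} (hu : ‖u‖ = 1) {T : ℕ} (hT : 0 < T) :
    ∃ j : ℕ, j < T ∧ Real.cos (π / T) ≤ (u * (starRingEnd ℂ) (eR ((j : ℝ) / T))).re := by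
  have hTr : (0 : ℝ) < T := by exact_mod_cast hT
  set q : ℝ := arg u * T / (2 * π) with hq
  set j₀ : ℤ := round q with hj₀
  have hround : |q - j₀| ≤ 1 / 2 := abs_sub_round q
  -- reduce modulo `T`
  set j : ℕ := (j₀ % (T : ℤ)).toNat with hj
  have hmod0 : 0 ≤ j₀ % (T : ℤ) := Int.emod_nonneg _ (by exact_mod_cast hT.ne')
  have hmodlt : j₀ % (T : ℤ) < T := Int.emod_lt_of_pos _ (by exact_mod_cast hT)
  have hjZ : (j : ℤ) = j₀ % (T : ℤ) := by rw [hj, Int.toNat_of_nonneg hmod0]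
  refine ⟨j, by omega, ?_⟩
  -- `e(j/T) = e(j₀/T)` by periodicity
  have hper : eR ((j : ℝ) / T) = eR ((j₀ : ℝ) / T) := by
    refine eR_eq_of_sub_eq_intCast (n := -(j₀ / (T : ℤ))) ?_
    have hdm : ((j₀ % T + T * (j₀ / T) : ℤ) : ℝ) = (j₀ : ℝ) := by exact_mod_cast Int.emod_add_mul_ediv j₀ T
    have hjr : (j : ℝ) = ((j₀ % (T : ℤ) : ℤ) : ℝ) := by exact_mod_cast hjZ
    have hq' : ((j₀ % (T : ℤ) : ℤ) : ℝ) = j₀ - (T : ℝ) * ((j₀ / (T : ℤ) : ℤ) : ℝ) := by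
      push_cast at hdm; linear_combination hdm
    rw [hjr, hq']; push_cast; field_simp; ring
  rw [hper, re_mul_conj_eR_eq_cos hu]
  -- `|arg u − 2π j₀/T| ≤ π/T`
  have hdiff : |arg u - 2 * π * ((j₀ : ℝ) / T)| ≤ π / T := by
    have : arg u - 2 * π * ((j₀ : ℝ) / T) = (2 * π / T) * (q - j₀) := by
      rw [hq]; field_simp; try ring
    rw [this, abs_mul, abs_of_pos (by positivity)]
    calc 2 * π / T * |q - j₀| ≤ 2 * π / T * (1 / 2) := by gcongr
      _ = π / T := by ring
  have hπT : π / T ≤ π := div_le_self pi_pos.le (by exact_mod_cast hT)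
  rcases le_or_gt 0 (arg u - 2 * π * ((j₀ : ℝ) / T)) with h | h
  · rw [abs_of_nonneg h] at hdiff
    exact cos_le_cos_of_nonneg_of_le_pi h hπT hdiff
  · rw [abs_of_neg h] at hdiff
    rw [← Real.cos_neg (arg u - 2 * π * ((j₀ : ℝ) / T))]
    exact cos_le_cos_of_nonneg_of_le_pi (by linarith) hπT hdiff

/-! ### The maximiser of the grid scores -/

/-- **The maximising grid angle is within `2π/T` of the phase.** If every score `σ_j`, `j < T`, is
within `ε₁` of `A · Re(u · conj e(j/T))` (`A > 0`) and `2ε₁ < A (cos(π/T) − cos(2π/T))`, then a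
maximiser `ĵ` has `Re(u · conj e(ĵ/T)) > cos(2π/T)`. [cite: VanDamSeroussi2002, §3.1 Fact 2 (estimating γ from measurements along |0⟩ + e^{iφ}|1⟩)] -/
theorem re_grid_max_gt {u : ℂ} (hu : ‖u‖ = 1) {T : ℕ} (hT : 0 < T) {A ε₁ : ℝ} (hA : 0 < A)
    (σ : ℕ → ℝ) (hσ : ∀ j, j < T → |σ j - A * (u * (starRingEnd ℂ) (eR ((j : ℝ) / T))).re| ≤ ε₁)
    (hε : 2 * ε₁ < A * (Real.cos (π / T) - Real.cos (2 * π / T)))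
    {jm : ℕ} (hjm : jm < T) (hmax : ∀ j, j < T → σ j ≤ σ jm) :
    Real.cos (2 * π / T) < (u * (starRingEnd ℂ) (eR ((jm : ℝ) / T))).re := by
  obtain ⟨j, hj, hjcos⟩ := exists_grid_ge_cos hu hT
  have h1 := abs_le.1 (hσ j hj)
  have h2 := abs_le.1 (hσ jm hjm)
  have h3 := hmax j hj
  -- `A Re_jm ≥ σ jm − ε₁ ≥ σ j − ε₁ ≥ A Re_j − 2ε₁ ≥ A cos(π/T) − 2ε₁ > A cos(2π/T)`
  have key : A * Real.cos (2 * π / T) < A * (u * (starRingEnd ℂ) (eR ((jm : ℝ) / T))).re := by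
    nlinarith [mul_le_mul_of_nonneg_left hjcos hA.le]
  exact lt_of_mul_lt_mul_left key hA.le

/-! ### The output of the post-processor -/

/-- **The grid output is a valid answer.** With `T = 4t`, `t ≥ 2`, scores as in `re_grid_max_gt` and a
maximiser `ĵ < 4t`, the output `m = ⌊(ĵ+2)/4⌋ mod t` satisfies `|arg(u · conj e(m/t))| ≤ 2π/t`: the
maximising angle is within `2π/(4t)` of `arg u`, and `2πm/t` is within `π/t` of it (modulo `2π`).
[cite: VanDamSeroussi2002, §3.1 Fact 2 and §4 Thm. 1] -/
theorem abs_arg_grid_output_le {u : ℂ} (hu : ‖u‖ = 1) {t : ℕ} (ht : 2 ≤ t) {A ε₁ : ℝ} (hA : 0 < A)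
    (σ : ℕ → ℝ) (hσ : ∀ j, j < 4 * t → |σ j - A * (u * (starRingEnd ℂ) (eR ((j : ℝ) / (4 * t : ℕ)))).re| ≤ ε₁)
    (hε : 2 * ε₁ < A * (Real.cos (π / (4 * t : ℕ)) - Real.cos (2 * π / (4 * t : ℕ))))
    {jm : ℕ} (hjm : jm < 4 * t) (hmax : ∀ j, j < 4 * t → σ j ≤ σ jm) :
    |arg (u * (starRingEnd ℂ) (eR ((((jm + 2) / 4 % t : ℕ) : ℝ) / t)))| ≤ 2 * π / t := by
  have htr : (0 : ℝ) < t := by exact_mod_cast (by omega : 0 < t)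
  have h4t : 0 < 4 * t := by omega
  have h4tr : ((4 * t : ℕ) : ℝ) = 4 * t := by push_cast; ring
  -- the maximising angle is close
  have hre := re_grid_max_gt hu h4t hA σ hσ hε hjm hmax
  set w := u * (starRingEnd ℂ) (eR ((jm : ℝ) / (4 * t : ℕ))) with hw
  have hwn : ‖w‖ = 1 := by rw [hw, norm_mul, Complex.norm_conj, norm_eR, hu, one_mul]
  have harg : |arg w| < 2 * π / ((4 * t : ℕ) : ℝ) := abs_arg_lt_of_re_gt_cos hwn (by positivity) hre
  rw [h4tr] at harg
  -- `w = exp(a i)` with `a = arg w`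
  set a := arg w with ha
  have hwexp : w = Complex.exp ((a : ℂ) * I) := eq_exp_arg_of_norm_eq_one hwn
  -- the output index
  set m₀ := (jm + 2) / 4 with hm₀
  have hm₀le : m₀ ≤ t := by omega
  have hjm4 : (4 * m₀ : ℤ) ≤ jm + 2 ∧ (jm : ℤ) + 2 < 4 * m₀ + 4 := by constructor <;> omega
  -- `e(m/t) = e(m₀/t)` with `m = m₀ mod t`
  have hper : eR ((((jm + 2) / 4 % t : ℕ) : ℝ) / t) = eR ((m₀ : ℝ) / t) := by
    rw [← hm₀]
    rcases Nat.lt_or_ge m₀ t with h | h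
    · rw [Nat.mod_eq_of_lt h]
    · have hm : m₀ = t := le_antisymm hm₀le h
      rw [hm, Nat.mod_self]
      refine eR_eq_of_sub_eq_intCast (n := -1) ?_
      push_cast; field_simp; ring
  rw [hper]
  -- `u conj e(m₀/t) = w · exp(δ i)` with `δ = 2π jm/(4t) − 2π m₀/t`, `|δ| ≤ π/t`
  set δ : ℝ := 2 * π * ((jm : ℝ) / (4 * t)) - 2 * π * ((m₀ : ℝ) / t) with hδ
  have hδabs : |δ| ≤ π / t := by
    have : δ = (π / (2 * t)) * ((jm : ℝ) - 4 * m₀) := by rw [hδ]; field_simp; ring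
    rw [this, abs_mul, abs_of_pos (by positivity)]
    have hb : |(jm : ℝ) - 4 * m₀| ≤ 2 := by
      rw [abs_le]; constructor
      · have : ((4 * m₀ : ℤ) : ℝ) ≤ (jm : ℝ) + 2 := by exact_mod_cast hjm4.1
        push_cast at this; linarith
      · have : (jm : ℝ) + 2 ≤ ((4 * m₀ + 4 : ℤ) : ℝ) := by exact_mod_cast hjm4.2.le
        push_cast at this; linarith
    calc π / (2 * t) * |(jm : ℝ) - 4 * m₀| ≤ π / (2 * t) * 2 := by gcongr
      _ = π / t := by field_simp; try ring
  have hprod : u * (starRingEnd ℂ) (eR ((m₀ : ℝ) / t)) = Complex.exp (((a + δ : ℝ) : ℂ) * I) := by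
    have h1 : u * (starRingEnd ℂ) (eR ((m₀ : ℝ) / t)) =
        w * eR ((jm : ℝ) / (4 * t : ℕ) - (m₀ : ℝ) / t) := by
      rw [hw, conj_eR, conj_eR, mul_assoc, ← eR_add]
      congr 2; ring
    rw [h1, hwexp, eR_eq_exp_mul_I, ← Complex.exp_add]
    congr 1
    rw [h4tr, hδ]; push_cast; ring
  rw [hprod]
  -- `|a + δ| < 3π/(2t) ≤ π`, so the argument is `a + δ`
  have hsum : |a + δ| < 3 * π / (2 * t) := by
    calc |a + δ| ≤ |a| + |δ| := abs_add_le _ _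
      _ < 2 * π / (4 * t) + π / t := add_lt_add_of_lt_of_le harg hδabs
      _ = 3 * π / (2 * t) := by field_simp; ring
  have h2t : (2 : ℝ) ≤ t := by exact_mod_cast ht
  have hsumπ : |a + δ| < π := by
    refine hsum.trans_le ?_
    rw [div_le_iff₀ (by positivity)]; nlinarith [pi_pos]
  have hmem : a + δ ∈ Set.Ioc (-π) π := ⟨by linarith [(abs_lt.1 hsumπ).1], (abs_lt.1 hsumπ).2.le⟩
  rw [arg_exp_ofReal_mul_I hmem]
  refine hsum.le.trans ?_
  rw [div_le_div_iff₀ (by positivity) htr]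
  nlinarith [pi_pos]

end VanDamSeroussi

end Literature.Computability.Cryptography
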